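import Literature.Barriers.CriticalPhenomena.LaceExpansionIsingDeconvolutionThm22
import Literature.Barriers.CriticalPhenomena.LaceExpansionIsingGreenDecayProofs
import Literature.Barriers.CriticalPhenomena.LaceExpansionKernelTaylor
import HarnessLib

/-!
# Liu–Slade 2024, Theorem 1.2 (critical case) assembled along its printed proof
# (`LiuSlade2024_thm12_critical_of_prop24`)

Barrier catalogue `Literature/Barriers/CriticalPhenomena/` (D-0021), the sibling announced by
`LaceExpansionGaussianDeconvolution.lean` (which decomposes Liu–Slade 2024, Theorem 1.2 —
`LiuSlade2024_thm12_critical` of `LaceExpansionIsingDeconvolutionParts.lean`, an input of Liu–Slade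
2026, Thm. 1.7 and hence of Sakai's theorem for the spread-out Ising model — into named inputs
along its printed proof, "Proof of Theorem 1.2 assuming Proposition 2.11", §2.3.2 of the source).
Of those inputs, Lemma 2.9 (`LiuSlade2024_lem29_holds`) and "`C_1` is the Fourier integral (1.5)"
(`srwGreen_eq_fourierInverseG_holds`) are theorems of
`LaceExpansionGaussianDeconvolutionLem29.lean`, Proposition 2.4 is the named fact
`LiuSlade2024_prop24`, and Proposition 2.11 is NOT a named fact (its transcription was merged
back into the obligation `LiuSlade2024_thm12_critical` on the review of 2026-08-15,
D-0026/D-0027: its printed proof is essentially the whole of §2.2–§2.3 and Appendix A). This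
file PROVES the elementary analysis of the assembly and the assembly itself, with Proposition 2.11
entering as the explicit hypothesis `h211` — spelled out verbatim in the reading that was reviewed
with the decomposition (every coordinate direction, `u ∈ [0,1]` in the coordinate `t = k/2π`,
every weak derivative, one constant for all `F` under Assumption 1.1):

* Part 1 — `F̂ ∘ σ* = F̂` and `f̂ ∘ σ* = f̂` for `ℤ^d`-symmetric `F` (`mFourier_torusSignedPerm`:
  `e_x(σ*t) = e_{σ⁻¹x}(t)`), the symmetry hypothesis of Lemma 2.9 for `h = f`;
* Part 2 — the absolute convergence of the Fourier integrals (1.8) and (1.5) for `d > 2` from the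
  infrared bounds (`integrable_inv_latticeFourier_of_infrared`, an instance of the tree's
  `integrable_inv_of_infrared`; the infrared bound (1.11) for `A_1 = δ - D_nn`,
  `Re Â_1(t) ≥ (8/d) Σ_i ‖t_i‖²`, `re_latticeFourier_lsA_one_ge`);
* Part 3 — (1.10) in the critical case: the infrared bound `K₂ Σ_i ‖t_i‖² ≤ Re F̂(t)` forces
  `F'' = -Σ_x |x|²F(x) ≥ dK₂/(2π²) > 0` (`ls24Fpp_ge`; "By Taylor's Theorem and Assumption 1.1",
  here through the tree's second-order expansion `abs_one_sub_re_latticeFT_sub_le` of Hara's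
  Lemma 2.1 applied to `J = δ - F` along `k = s e₁`, `s ↓ 0` — `K0_le_secondMoment`, the tree's
  `HaraKernelHyp.K0_le_K1` with explicit hypotheses);
* Part 4 — `f = G - λC_1` in the critical case (`fourierInverseG_sub_lambda_mul_srwGreen`:
  linearity of the absolutely convergent Fourier integrals, `μ = 1`, `C_1 = ∫ e_{-x}/Â_1`);
* Part 5 — the exponents: for `s < ρ ∧ 2 ∧ (ρ - (d-8)/2)` there are `0 < δ < η < 1` with
  `d - 2 + s ≤ n_d + δ` and `n_d + η < (d - 2 + ρ ∧ 2) ∧ (d/2 + 2 + ρ)` (`ls24_exists_exponents`);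
* Part 6 — the assembly `LiuSlade2024_thm12_critical_of_prop24 (h24 : LiuSlade2024_prop24)
  (h211 : ⟨Proposition 2.11⟩) : LiuSlade2024_thm12_critical`: Lemma 2.9 with `a = n_d + δ`,
  weak derivatives and `L¹` bounds from Proposition 2.4, the `U_u`-bounds from `h211`, then
  `G = λC_1 + f`, `λ = 1/F'' ≤ 2π²/(dK₂)` and (1.6) (`srwGreen_asymp_holds`) give (1.14) with a
  constant depending on `d, K₁, K₂, ρ, s` only.

So the open obligation `LiuSlade2024_thm12_critical` is reduced, in Lean, to Proposition 2.4
(`LiuSlade2024_prop24`) and Proposition 2.11 (the hypothesis `h211`). No definitions, no named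
facts.

## References

* Y. Liu, G. Slade, *Gaussian deconvolution and the lace expansion*, Probab. Theory Related
  Fields 195 (2024) 3–29, arXiv:2310.07635: §1.2 ((1.5), (1.6), (1.8)–(1.14), Assumption 1.1,
  Theorem 1.2), §2.1 (`G = λC_μ + f`), §2.2 (definition of `n_d`), §2.3.2 (Proposition 2.11 and
  "Proof of Theorem 1.2 assuming Proposition 2.11") [LiuSlade2024].
* T. Hara, *Decay of correlations in nearest-neighbor self-avoiding walk, percolation, lattice
  trees and animals*, Ann. Probab. 36 (2008): Lemma 2.1 and the proof of Lemma 2.2 (the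
  second-order expansion of `1 - Re Ĵ` and "`K₀ ≤ K₁`") [Hara2008].
-/

noncomputable section

namespace Literature.Barriers.CriticalPhenomena.SpreadOutIsing

open Filter Finset UnitAddTorus Literature.Probability.LatticeModels
open Literature.Probability.Percolation
open Literature.Analysis.FunctionSpaces
open _root_.MeasureTheory _root_.Topology
open scoped ENNReal

variable {d : ℕ}

/-! ## Part 1. `ℤ^d`-symmetry on the torus side: `F̂ ∘ σ* = F̂` -/

/-- The characters transform under the dual action of a signed coordinate permutation by
`e_x(σ* t) = e_{σ⁻¹ x}(t)`. [folklore] -/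
theorem mFourier_torusSignedPerm (π : Equiv.Perm (Fin d)) (ε : Fin d → ℤˣ) (x : Site d)
    (t : UnitAddTorus (Fin d)) :
    mFourier x (torusSignedPerm π ε t) = mFourier ((Site.signedPerm π ε).symm x) t := by
  simp only [mFourier, ContinuousMap.coe_mk, torusSignedPerm]
  rw [← Equiv.prod_comp π (fun i => fourier (x i) ((ε i : ℤ) • t (π.symm i)))]
  refine Finset.prod_congr rfl fun j _ => ?_
  rw [Equiv.symm_apply_apply, Site.signedPerm_symm_apply, fourier_apply, fourier_apply, smul_smul,
    mul_comm]

/-- **`F̂ ∘ σ* = F̂` for a `ℤ^d`-symmetric `F`** (reindex the character sum by `σ`).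
[cite: LiuSlade2024, Assumption 1.1 (ℤ^d-symmetry)] -/
theorem latticeFourier_torusSignedPerm {F : Site d → ℝ} (hF : IsZdSymmetric F)
    (π : Equiv.Perm (Fin d)) (ε : Fin d → ℤˣ) (t : UnitAddTorus (Fin d)) :
    latticeFourier F (torusSignedPerm π ε t) = latticeFourier F t := by
  unfold latticeFourier
  simp_rw [mFourier_torusSignedPerm]
  rw [← Equiv.tsum_eq (Site.signedPerm π ε)
    (fun x => (F x : ℂ) * mFourier ((Site.signedPerm π ε).symm x) t)]
  simp only [Equiv.symm_apply_apply, hF π ε]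

/-- `D_nn` is `ℤ^d`-symmetric (signed coordinate permutations are graph automorphisms of `ℤ^d`
fixing the origin). [folklore] -/
theorem isZdSymmetric_srwStep : IsZdSymmetric (srwStep d) := by
  intro π ε x
  have h : (zdGraph d).Adj 0 (Site.signedPerm π ε x) ↔ (zdGraph d).Adj 0 x := by
    have := (zdSignedPermIso π ε).map_adj_iff (v := 0) (w := x)
    simpa using this
  unfold srwStep
  rw [if_congr h rfl rfl]

/-- `A_μ = δ - μD_nn` is `ℤ^d`-symmetric. [folklore] -/
theorem isZdSymmetric_lsA (μ : ℝ) : IsZdSymmetric (lsA d μ) := fun π ε x => by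
  simp only [lsA, isZdSymmetric_delta0 π ε x, isZdSymmetric_srwStep π ε x]

/-- **`f̂ ∘ σ* = f̂`**: the error transform `f̂ = 1/F̂ - λ/Â_μ` of a `ℤ^d`-symmetric `F` is
invariant under the dual action of the signed coordinate permutations (the symmetry hypothesis of
Lemma 2.9 for `h = f`). [cite: LiuSlade2024, Assumption 1.1 (ℤ^d-symmetry) and Lemma 2.9] -/
theorem ls24fHat_torusSignedPerm {F : Site d → ℝ} (hF : IsZdSymmetric F)
    (π : Equiv.Perm (Fin d)) (ε : Fin d → ℤˣ) (t : UnitAddTorus (Fin d)) :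
    ls24fHat F (torusSignedPerm π ε t) = ls24fHat F t := by
  simp only [ls24fHat, latticeFourier_torusSignedPerm hF,
    latticeFourier_torusSignedPerm (isZdSymmetric_lsA (d := d) (ls24Mu F))]

/-! ## Part 2. Absolute convergence of the Fourier integrals (1.5), (1.8) for `d > 2` -/

/-- **Absolute convergence of (1.8), `∫_{𝕋^d} dt/F̂(t)`, for `d > 2`** under the (critical) infrared
bound of Theorem 1.2 in the coordinate `k = 2πt`, `K₂ Σ_i ‖t_i‖² ≤ Re F̂(t)` ("We are interested in
functions `F` satisfying the following assumptions, which in particular imply the absolute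
convergence of the above integral"); an instance of the tree's `integrable_inv_of_infrared`
(`|1/F̂| ≲ ‖y‖^{-2}` on the fundamental domain, integrable near the origin in dimension `≥ 3`).
[cite: LiuSlade2024, §1.2, (1.8) and the sentence preceding Assumption 1.1] -/
theorem integrable_inv_latticeFourier_of_infrared (hd : 3 ≤ d) {F : Site d → ℝ}
    (hF : Summable fun x => |F x|) {K₂ : ℝ} (hK₂ : 0 < K₂)
    (hIR : ∀ t : UnitAddTorus (Fin d), K₂ * ∑ i, ‖t i‖ ^ 2 ≤ (latticeFourier F t).re) :
    Integrable (fun t : UnitAddTorus (Fin d) => (latticeFourier F t)⁻¹) :=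
  integrable_inv_of_infrared hd (continuous_latticeFourier hF) hK₂ fun t =>
    (mul_le_mul_of_nonneg_left (min_le_left _ _) hK₂.le).trans (hIR t)

/-- `Â_1 = 1 - D̂_nn` in the cube coordinate: `Â_1(class of y) = 1 - D̂_nn(-2πy)`.
[cite: LiuSlade2024, §2.1 (A_μ = δ - μD) and (1.11)] -/
theorem latticeFourier_lsA_one_coe (y : Fin d → ℝ) :
    latticeFourier (lsA d 1) (fun i => ((y i : ℝ) : UnitAddCircle)) =
      1 - latticeFT (srwStep d) ((-(2 * Real.pi)) • y) := by
  rw [latticeFourier_coe_eq_latticeFT]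
  have hJ : lsA d 1 = fun x => delta0 x - srwStep d x := funext fun x => lsA_one x
  rw [hJ, ← one_sub_latticeFT_delta0_sub summable_abs_srwStep, sub_sub_cancel]

/-- **The infrared bound (1.11) for `A_1` on the fundamental domain**:
`Re Â_1(y) = d⁻¹ Σ_i (1 - cos 2πy_i) ≥ (8/d) Σ_i y_i²` for `|y_i| ≤ 1/2` (Jordan's inequality
`1 - cos u ≥ (2/π²)u²` on `[-π, π]`; the source's `(2μ/π²d)|k|²` with `k = 2πy`, `μ = 1`).
[cite: LiuSlade2024, (1.11)] -/
theorem infrared_lsA_one (hd : 1 ≤ d) (y : Fin d → ℝ) (hy : ∀ i, |y i| ≤ 1 / 2) :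
    8 / d * ∑ i, y i ^ 2 ≤
      (latticeFourier (lsA d 1) (fun i => ((y i : ℝ) : UnitAddCircle))).re := by
  have hd0 : (0 : ℝ) < d := by exact_mod_cast hd
  rw [latticeFourier_lsA_one_coe, Complex.sub_re, Complex.one_re, one_sub_re_latticeFT_srwStep hd]
  unfold dispersion
  rw [le_div_iff₀ hd0]
  calc 8 / (d : ℝ) * (∑ i, y i ^ 2) * d = 8 * ∑ i, y i ^ 2 := by field_simp
    _ = ∑ i, 8 * y i ^ 2 := by rw [Finset.mul_sum]
    _ ≤ ∑ i, (1 - Real.cos (((-(2 * Real.pi)) • y) i)) := Finset.sum_le_sum fun i _ => ?_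
  have hk : |((-(2 * Real.pi)) • y) i| ≤ Real.pi := by
    rw [Pi.smul_apply, smul_eq_mul, abs_mul, abs_neg, abs_of_pos Real.two_pi_pos]
    have := hy i
    nlinarith [Real.pi_pos]
  have hcos := Real.cos_le_one_sub_mul_cos_sq hk
  have hsq : ((-(2 * Real.pi)) • y) i ^ 2 = 4 * Real.pi ^ 2 * y i ^ 2 := by
    rw [Pi.smul_apply, smul_eq_mul]; ring
  rw [hsq] at hcos
  have hπ : Real.pi ≠ 0 := Real.pi_ne_zero
  have : 2 / Real.pi ^ 2 * (4 * Real.pi ^ 2 * y i ^ 2) = 8 * y i ^ 2 := by field_simp; ring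
  linarith

/-- (1.11) on the whole torus: `Re Â_1(t) ≥ (8/d) Σ_i ‖t_i‖²` (every class has a representative in
`[-1/2, 1/2]^d`, on which `‖t_i‖ = |y_i|`). [cite: LiuSlade2024, (1.11)] -/
theorem re_latticeFourier_lsA_one_ge (hd : 1 ≤ d) (t : UnitAddTorus (Fin d)) :
    8 / d * ∑ i, ‖t i‖ ^ 2 ≤ (latticeFourier (lsA d 1) t).re := by
  obtain ⟨y, hy, hyt, hnorm⟩ := exists_rep_unitAddTorus t
  have h := infrared_lsA_one hd y hy
  rw [hyt] at h
  have hs : ∑ i, ‖t i‖ ^ 2 = ∑ i, y i ^ 2 :=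
    Finset.sum_congr rfl fun i _ => by rw [hnorm i, sq_abs]
  rwa [hs]

/-- Hence `1/Â_1` is integrable on the torus for `d > 2`: (1.5) at `μ = 1` converges absolutely.
[cite: LiuSlade2024, (1.5) and (1.11)] -/
theorem integrable_inv_latticeFourier_lsA_one (hd : 3 ≤ d) :
    Integrable (fun t : UnitAddTorus (Fin d) => (latticeFourier (lsA d 1) t)⁻¹) := by
  have hsum : Summable fun x : Site d => |lsA d 1 x| := by
    simp_rw [lsA_one]
    exact (summable_abs_delta0.of_abs.sub summable_abs_srwStep.of_abs).abs
  have hd0 : (0 : ℝ) < d := by exact_mod_cast (show 0 < d by omega)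
  exact integrable_inv_latticeFourier_of_infrared hd hsum (by positivity : (0 : ℝ) < 8 / d)
    (re_latticeFourier_lsA_one_ge (by omega))

/-! ## Part 3. (1.10): the infrared bound forces `F'' ≥ dK₂/(2π²) > 0` -/

/-- **`K₀ ≤ Σ_x |x|² J(x)`** for a `ℤ^d`-symmetric kernel `J` with `Σ_x J(x) = 1`,
`Σ_x |x|^{2+θ}|J(x)| < ∞` for some `θ ∈ (0, 2]`, and the infrared lower bound
`K₀|k|²/(2d) ≤ 1 - Re Ĵ(k)` on `[-π,π]^d`: compare along `k = s e₁`, `s ↓ 0`, with the expansion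
`1 - Re Ĵ(k) = K₁|k|²/(2d) + O(|k|^{2+θ})` (`abs_one_sub_re_latticeFT_sub_le`). This is the tree's
`HaraKernelHyp.K0_le_K1` with its hypotheses made explicit (no positivity of `K₁` assumed).
[cite: Hara2008, proof of Lemma 2.2 ("using K₀ ≤ K₁") and Lemma 2.1]
[cite: LiuSlade2024, (1.10) ("By Taylor's Theorem and Assumption 1.1")] -/
theorem K0_le_secondMoment {J : Site d → ℝ} (hd : 1 ≤ d) (hJs : IsZdSymmetric J) (hJ1 : HasSum J 1)
    (h2 : Summable fun x => euclidNorm x ^ 2 * |J x|) {θ : ℝ} (hθ0 : 0 < θ) (hθ2 : θ ≤ 2)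
    (hθs : Summable fun x => euclidNorm x ^ (2 + θ) * |J x|) {K₀ : ℝ}
    (hlow : ∀ k ∈ cube d, K₀ * (∑ i, k i ^ 2) / (2 * d) ≤ 1 - (latticeFT J k).re) :
    K₀ ≤ ∑' x, euclidNorm x ^ 2 * J x := by
  set K₁ := ∑' x, euclidNorm x ^ 2 * J x with hK₁
  set M := ∑' x, euclidNorm x ^ (2 + θ) * |J x| with hM
  have hM0 : 0 ≤ M :=
    tsum_nonneg fun x => mul_nonneg (Real.rpow_nonneg (euclidNorm_nonneg x) _) (abs_nonneg _)
  have hd0 : (0 : ℝ) < d := by exact_mod_cast hd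
  have i0 : Fin d := ⟨0, hd⟩
  -- along `k = s e₁`: `K₀ ≤ K₁ + 5 d M s^θ` for `0 < s ≤ 1`
  have key : ∀ s : ℝ, 0 < s → s ≤ 1 → K₀ ≤ K₁ + 5 * d * M * s ^ θ := by
    intro s hs hs1
    have hsπ : |s| ≤ Real.pi := by rw [abs_of_pos hs]; linarith [Real.pi_gt_three]
    have hk := hlow (Pi.single i0 s) (single_mem_cube i0 hsπ)
    have hR := abs_one_sub_re_latticeFT_sub_le hJs hJ1 h2 hθ0.le hθ2 hθs (Pi.single i0 s)
    rw [sum_sq_single] at hk hR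
    have hkn : knorm (Pi.single i0 s : Fin d → ℝ) = s := by
      rw [knorm, sum_sq_single, Real.sqrt_sq hs.le]
    rw [hkn] at hR
    have hR' := (abs_le.1 hR).2
    have hs2 : s ^ (2 + θ) = s ^ 2 * s ^ θ := by
      rw [Real.rpow_add hs, show s ^ (2 : ℝ) = s ^ 2 by norm_cast]
    rw [hs2] at hR'
    have hss : 0 < s ^ 2 := by positivity
    have h3 : K₀ * s ^ 2 / (2 * d) ≤ K₁ * s ^ 2 / (2 * d) + 5 / 2 * M * (s ^ 2 * s ^ θ) := by
      linarith
    have h4 : K₀ * s ^ 2 ≤ (K₁ + 5 * d * M * s ^ θ) * s ^ 2 := by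
      have := mul_le_mul_of_nonneg_right h3 (by positivity : (0 : ℝ) ≤ 2 * d)
      have e1 : K₀ * s ^ 2 / (2 * d) * (2 * d) = K₀ * s ^ 2 := by field_simp
      have e2 : (K₁ * s ^ 2 / (2 * d) + 5 / 2 * M * (s ^ 2 * s ^ θ)) * (2 * d) =
          (K₁ + 5 * d * M * s ^ θ) * s ^ 2 := by field_simp
      rw [e1, e2] at this; exact this
    exact le_of_mul_le_mul_right h4 hss
  -- let `s ↓ 0`
  by_contra hlt
  rw [not_le] at hlt
  rcases eq_or_lt_of_le hM0 with hM00 | hMpos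
  · have := key 1 one_pos le_rfl
    rw [← hM00] at this; simp at this; linarith
  · set δ := (K₀ - K₁) / (10 * d * M) with hδ
    have hδ0 : 0 < δ := by rw [hδ]; exact div_pos (by linarith) (by positivity)
    set s := min 1 (δ ^ (1 / θ)) with hs
    have hs0 : 0 < s := lt_min one_pos (Real.rpow_pos_of_pos hδ0 _)
    have hs1 : s ≤ 1 := min_le_left _ _
    have hsθ : s ^ θ ≤ δ := by
      have h1 : s ≤ δ ^ (1 / θ) := min_le_right _ _
      calc s ^ θ ≤ (δ ^ (1 / θ)) ^ θ := Real.rpow_le_rpow hs0.le h1 hθ0.le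
        _ = δ := by rw [← Real.rpow_mul hδ0.le, one_div_mul_cancel hθ0.ne', Real.rpow_one]
    have := key s hs0 hs1
    have h2 : 5 * d * M * s ^ θ ≤ 5 * d * M * δ := by gcongr
    have h3 : 5 * d * M * δ = (K₀ - K₁) / 2 := by rw [hδ]; field_simp; ring
    linarith

/-- The class in `(ℝ/ℤ)^d` of `-k/2π` for `k ∈ [-π,π]^d`: `F̂` there is Hara's `latticeFT F k`, and
its coordinates have quotient norm `|k_i|/2π`. [folklore] -/
theorem latticeFourier_coe_neg_div (F : Site d → ℝ) (k : Fin d → ℝ) :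
    latticeFourier F (fun i => (((-(2 * Real.pi))⁻¹ * k i : ℝ) : UnitAddCircle)) =
      latticeFT F k := by
  have h := latticeFourier_coe_eq_latticeFT F ((-(2 * Real.pi))⁻¹ • k)
  have hne : (-(2 * Real.pi) : ℝ) ≠ 0 := neg_ne_zero.2 (by positivity)
  rw [smul_inv_smul₀ hne] at h
  simpa only [Pi.smul_apply, smul_eq_mul] using h

/-- On `[-1/2, 1/2]` the quotient norm of `ℝ/ℤ` is the absolute value. [folklore] -/
private theorem norm_coe_unitAddCircle_eq_abs {v : ℝ} (hv : |v| ≤ 1 / 2) :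
    ‖((v : ℝ) : UnitAddCircle)‖ = |v| :=
  (AddCircle.norm_coe_eq_abs_iff (1 : ℝ) one_ne_zero).2 (by rwa [abs_one])

/-- For `k ∈ [-π,π]^d`, `Σ_i ‖(-k_i/2π mod 1)‖² = Σ_i k_i²/(4π²)`. [folklore] -/
theorem sum_norm_coe_neg_div_sq {k : Fin d → ℝ} (hk : k ∈ cube d) :
    ∑ i, ‖((((-(2 * Real.pi))⁻¹ * k i : ℝ) : UnitAddCircle))‖ ^ 2 =
      (∑ i, k i ^ 2) / (4 * Real.pi ^ 2) := by
  rw [Finset.sum_div]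
  refine Finset.sum_congr rfl fun i _ => ?_
  have hki : |k i| ≤ Real.pi := abs_le.2 (hk i (Set.mem_univ _))
  have hπ : 0 < Real.pi := Real.pi_pos
  have hy : |(-(2 * Real.pi))⁻¹ * k i| ≤ 1 / 2 := by
    rw [abs_mul, abs_inv, abs_neg, abs_of_pos (by positivity : (0 : ℝ) < 2 * Real.pi)]
    rw [inv_mul_le_iff₀ (by positivity)]
    linarith
  rw [norm_coe_unitAddCircle_eq_abs hy, sq_abs]
  field_simp
  ring

/-- **(1.10) in the critical case: `F'' = -Σ_x |x|²F(x) ≥ dK₂/(2π²)`** for a `ℤ^d`-symmetric `F`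
with `|F(x)| ≤ K₁⟦x⟧^{-(d+2+ρ)}`, `Σ_x F(x) = 0` and the infrared bound `K₂ Σ_i ‖t_i‖² ≤ Re F̂(t)`
on the torus (coordinate `k = 2πt`; the source's `F'' ≥ 2dK₂` for its `K₂|k|²`): apply
`K0_le_secondMoment` to `J = δ - F` (`Ĵ = 1 - F̂`, `Σ_x |x|²J(x) = F''`), reading the infrared bound
at the class of `-k/2π`. [cite: LiuSlade2024, (1.10) with Assumption 1.1 (1.9)] -/
theorem ls24Fpp_ge (hd : 1 ≤ d) {F : Site d → ℝ} {K₁ K₂ ρ : ℝ} (hρ : 0 < ρ)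
    (hFs : IsZdSymmetric F) (hdec : ∀ x, |F x| ≤ K₁ / jnorm x ^ ((d : ℝ) + 2 + ρ))
    (h0 : ∑' x, F x = 0)
    (hIR : ∀ t : UnitAddTorus (Fin d), K₂ * ∑ i, ‖t i‖ ^ 2 ≤ (latticeFourier F t).re) :
    d * K₂ / (2 * Real.pi ^ 2) ≤ ls24Fpp F := by
  set J : Site d → ℝ := fun y => delta0 y - F y with hJ
  have hFabs : Summable fun x => |F x| := summable_abs_of_decay hdec (by linarith)
  -- decay of `J`
  have hK₁ : |F 0| ≤ K₁ := by simpa using hdec 0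
  have hJdec : ∀ y, |J y| ≤ (1 + K₁) / jnorm y ^ ((d : ℝ) + 2 + ρ) := by
    intro y
    have hj := jnorm_pos y
    by_cases hy : y = 0
    · subst hy
      simp only [hJ, delta0, if_true, jnorm_zero, Real.one_rpow, div_one]
      calc |1 - F 0| ≤ |(1 : ℝ)| + |F 0| := abs_sub _ _
        _ ≤ 1 + K₁ := by rw [abs_one]; linarith
    · simp only [hJ, delta0_of_ne_zero hy, zero_sub, abs_neg]
      refine (hdec y).trans (div_le_div_of_nonneg_right ?_ (Real.rpow_nonneg hj.le _))
      linarith [abs_nonneg (F 0)]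
  have hJs : IsZdSymmetric J := fun π ε y => by
    simp only [hJ, isZdSymmetric_delta0 π ε y, hFs π ε y]
  have hJ1 : HasSum J 1 := by
    have h1 : HasSum (delta0 : Site d → ℝ) 1 := by
      have := hasSum_single (f := (delta0 : Site d → ℝ)) 0 (fun b hb => delta0_of_ne_zero hb)
      simpa [delta0] using this
    have h2 : HasSum F 0 := by rw [← h0]; exact hFabs.of_abs.hasSum
    simpa using h1.sub h2
  have h2 : Summable fun x => euclidNorm x ^ 2 * |J x| := by
    have := summable_rpow_mul_abs_of_decay hJdec zero_le_two (by linarith : (d : ℝ) < d + 2 + ρ - 2)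
    simpa only [Real.rpow_two] using this
  set θ := min ρ 2 / 2 with hθ
  have hθ0 : 0 < θ := by rw [hθ]; exact half_pos (lt_min hρ two_pos)
  have hθ2 : θ ≤ 2 := by
    rw [hθ]; have := min_le_right ρ 2; linarith
  have hθρ : θ < ρ := by
    rw [hθ]; have := min_le_left ρ 2; linarith
  have hθs : Summable fun x => euclidNorm x ^ (2 + θ) * |J x| :=
    summable_rpow_mul_abs_of_decay hJdec (by linarith) (by linarith)
  -- the infrared bound on the cube for `J`
  have hlow : ∀ k ∈ cube d, d * K₂ / (2 * Real.pi ^ 2) * (∑ i, k i ^ 2) / (2 * d) ≤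
      1 - (latticeFT J k).re := by
    intro k hk
    have hd0 : (0 : ℝ) < d := by exact_mod_cast hd
    have h1 : 1 - (latticeFT J k).re = (latticeFT F k).re := by
      rw [← one_sub_latticeFT_delta0_sub hFabs k, Complex.sub_re, Complex.one_re]
    have h2 := hIR (fun i => (((-(2 * Real.pi))⁻¹ * k i : ℝ) : UnitAddCircle))
    rw [latticeFourier_coe_neg_div, sum_norm_coe_neg_div_sq hk] at h2
    rw [h1]
    refine le_trans (le_of_eq ?_) h2
    field_simp
    ring
  have hmain := K0_le_secondMoment hd hJs hJ1 h2 hθ0 hθ2 hθs hlow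
  -- `Σ |x|² J(x) = F''`
  have hsq : ∑' x, euclidNorm x ^ 2 * J x = ls24Fpp F := by
    rw [ls24Fpp, ← tsum_neg]
    refine tsum_congr fun y => ?_
    simp only [hJ, mul_sub, sq_mul_delta0, zero_sub]
  rwa [hsq] at hmain

/-! ## Part 4. `f = G - λC_1` in the critical case -/

/-- **`f = G - λC_1`** ("`G = λC_μ + f`" of §2.1 with `μ = 1` in the critical case `F̂(0) = 0`):
for `d > 2` and `f̂ = 1/F̂ - λ/Â_1` integrable, `Re 𝓕f̂(x) = G(x) - λ C_1(x)`, where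
`G(x) = Re ∫ e_{-x}/F̂` is (1.8) and `C_1(x) = Σ_n D_nn^{*n}(x) = ∫ e_{-x}/Â_1` is (1.5)
(`srwGreen_eq_fourierInverseG_holds`; the two Fourier integrals converge absolutely, `1/Â_1` by
`integrable_inv_latticeFourier_lsA_one` and `1/F̂ = f̂ + λ/Â_1`).
[cite: LiuSlade2024, §2.1 (G = λC_μ + f) and (1.12) (μ = 1, λ = 1/F'' in the critical case)] -/
theorem fourierInverseG_sub_lambda_mul_srwGreen (hd : 3 ≤ d) {F : Site d → ℝ}
    (hint : Integrable (ls24fHat F)) (h0 : ∑' x, F x = 0) (x : Site d) :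
    fourierInverseG F x - ls24Lambda F * srwGreen d x = (mFourierCoeff (ls24fHat F) x).re := by
  have hμ : ls24Mu F = 1 := ls24Mu_of_tsum_eq_zero h0
  have hA := integrable_inv_latticeFourier_lsA_one (d := d) hd
  have hlA : Integrable fun t : UnitAddTorus (Fin d) =>
      (ls24Lambda F : ℂ) * (latticeFourier (lsA d 1) t)⁻¹ := hA.const_mul _
  have hfeq : ls24fHat F = fun t =>
      (latticeFourier F t)⁻¹ - (ls24Lambda F : ℂ) * (latticeFourier (lsA d 1) t)⁻¹ := by
    funext t; simp only [ls24fHat, hμ]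
  have hF : Integrable fun t : UnitAddTorus (Fin d) => (latticeFourier F t)⁻¹ := by
    refine (hint.add hlA).congr (ae_of_all _ fun t => ?_)
    simp only [Pi.add_apply, hfeq]
    ring
  rw [srwGreen_eq_fourierInverseG_holds d (by omega) x, fourierInverseG, fourierInverseG, hfeq,
    mFourierCoeff_sub hF hlA, mFourierCoeff_const_mul, Complex.sub_re, Complex.re_ofReal_mul]

/-! ## Part 5. The exponents of the proof of Theorem 1.2 -/

/-- **The exponent bookkeeping of "Proof of Theorem 1.2 assuming Proposition 2.11"**: for
`s < ρ ∧ 2 ∧ (ρ - (d-8)/2)` there are `0 < δ < η < 1` with `d - 2 + s ≤ n_d + δ` and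
`n_d + η < (d - 2 + ρ ∧ 2) ∧ (d/2 + 2 + ρ)` (the source takes `δ = s - ⌊s⌋` for `s` close to the
upper limit and "Since we have a strict inequality, we can pick an `η ∈ (δ, 1)` satisfying (2.35)";
here `n_d = d - 2 + s₀` is the display defining `n_d`, `lsND`).
[cite: LiuSlade2024, §2.3.2 (Proof of Theorem 1.2 assuming Proposition 2.11) and §2.2 (n_d)] -/
theorem ls24_exists_exponents (hd : 3 ≤ d) {ρ s : ℝ} (hρ : max (((d : ℝ) - 8) / 2) 0 < ρ)
    (hs : s < min (min ρ 2) (ρ - ((d : ℝ) - 8) / 2)) :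
    ∃ δ η : ℝ, 0 < δ ∧ δ < η ∧ η < 1 ∧
      (d : ℝ) - 2 + s ≤ (lsND d ρ : ℝ) + δ ∧
      (lsND d ρ : ℝ) + η < min ((d : ℝ) - 2 + min ρ 2) ((d : ℝ) / 2 + 2 + ρ) := by
  set sm := min (min ρ 2) (ρ - ((d : ℝ) - 8) / 2) with hsm
  have hρ0 : 0 < ρ := lt_of_le_of_lt (le_max_right _ _) hρ
  have hρ8 : ((d : ℝ) - 8) / 2 < ρ := lt_of_le_of_lt (le_max_left _ _) hρ
  have hsm0 : 0 < sm := lt_min (lt_min hρ0 two_pos) (by linarith)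
  have hd2 : ((d - 2 : ℕ) : ℝ) = (d : ℝ) - 2 := by
    rw [Nat.cast_sub (by omega)]; norm_num
  have hd1 : ((d - 1 : ℕ) : ℝ) = (d : ℝ) - 1 := by
    rw [Nat.cast_sub (by omega)]; norm_num
  have hkey : min ((d : ℝ) - 2 + min ρ 2) ((d : ℝ) / 2 + 2 + ρ) = (d : ℝ) - 2 + sm := by
    rw [hsm, ← min_add_add_left ((d : ℝ) - 2) (min ρ 2) (ρ - ((d : ℝ) - 8) / 2)]
    congr 1
    ring
  by_cases hc : ρ ≤ 1 + max (((d : ℝ) - 8) / 2) 0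
  · -- `n_d = d - 2`, and `sm ≤ 1`
    have hN : (lsND d ρ : ℝ) = (d : ℝ) - 2 := by
      simp only [lsND, if_pos hc, hd2]
    have hsm1 : sm ≤ 1 := by
      rcases le_or_gt (((d : ℝ) - 8) / 2) 0 with h8 | h8
      · rw [max_eq_right h8] at hc
        exact (min_le_left _ _).trans ((min_le_left _ _).trans (by linarith))
      · rw [max_eq_left h8.le] at hc
        exact (min_le_right _ _).trans (by linarith)
    set m := max s 0 with hm
    have hm0 : 0 ≤ m := le_max_right _ _
    have hms : s ≤ m := le_max_left _ _
    have hm_lt : m < sm := max_lt hs hsm0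
    refine ⟨m + (sm - m) / 3, m + 2 * (sm - m) / 3, by linarith, by linarith, by linarith, ?_, ?_⟩
    · rw [hN]; linarith
    · rw [hkey, hN]; linarith
  · -- `n_d = d - 1`, and `1 < sm ≤ 2`
    rw [not_le] at hc
    have hN : (lsND d ρ : ℝ) = (d : ℝ) - 1 := by
      simp only [lsND, if_neg (not_le.2 hc), hd1]
    have hmax0 : (0 : ℝ) ≤ max (((d : ℝ) - 8) / 2) 0 := le_max_right _ _
    have hmax8 : ((d : ℝ) - 8) / 2 ≤ max (((d : ℝ) - 8) / 2) 0 := le_max_left _ _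
    have hsm1 : 1 < sm := lt_min (lt_min (by linarith) one_lt_two) (by linarith)
    have hsm2 : sm ≤ 2 := (min_le_left _ _).trans (min_le_right _ _)
    set m := max (s - 1) 0 with hm
    have hm0 : 0 ≤ m := le_max_right _ _
    have hms : s - 1 ≤ m := le_max_left _ _
    have hm_lt : m < sm - 1 := max_lt (by linarith) (by linarith)
    refine ⟨m + (sm - 1 - m) / 3, m + 2 * (sm - 1 - m) / 3, by linarith, by linarith, by linarith,
      ?_, ?_⟩
    · rw [hN]; linarith
    · rw [hkey, hN]; linarith

/-! ## Part 6. The assembly: Theorem 1.2 (critical case) from Lemma 2.9, Proposition 2.4,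
Proposition 2.11 and the asymptotics of `C_1` -/

/-- **Liu–Slade 2024, Theorem 1.2 in the critical case, assembled along its printed proof**
("Proof of Theorem 1.2 assuming Proposition 2.11", §2.3.2): from Proposition 2.4 (the named fact
`LiuSlade2024_prop24`: `f̂` is `n_d` times weakly differentiable with `L¹` bounds uniform in `F`)
and Proposition 2.11 — NOT a named fact of the tree (merged back into this obligation on the
review of 2026-08-15, see `LaceExpansionGaussianDeconvolution.lean`); it enters here as the
explicit hypothesis `h211`, spelled out verbatim in the reviewed reading — the hypotheses of
Lemma 2.9 (`LiuSlade2024_lem29_holds`) hold for `h = f`, `a = n_d + δ ≥ d - 2 + s`, `η ∈ (δ, 1)`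
(`ls24_exists_exponents`), whence `|f(x)| ≲ ⟦x⟧^{-(d-2+s)}` uniformly in `F`; and
`G = λC_1 + f` (`fourierInverseG_sub_lambda_mul_srwGreen`) with `λ = 1/F''`,
`F'' ≥ dK₂/(2π²)` (`ls24Fpp_ge`, (1.10)) and `C_1(x) = a_d⟦x⟧^{-(d-2)} + O(⟦x⟧^{-d})` ((1.6),
`srwGreen_asymp_holds`) give (1.14): `G(x) = a_d/(F''⟦x⟧^{d-2}) + O(⟦x⟧^{-(d-2+s)})` with a
constant depending on `d, K₁, K₂, ρ, s` only.
[cite: LiuSlade2024, Theorem 1.2 with (1.13)–(1.14) and §2.3.2 (Proof of Theorem 1.2)] -/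
theorem LiuSlade2024_thm12_critical_of_prop24 (h24 : LiuSlade2024_prop24)
    (h211 : ∀ d : ℕ, 2 < d → ∀ K₁ K₂ ρ η : ℝ, 0 < K₁ → 0 < K₂ → max (((d : ℝ) - 8) / 2) 0 < ρ →
      0 < η → η < 1 →
      (lsND d ρ : ℝ) + η < min ((d : ℝ) - 2 + min ρ 2) ((d : ℝ) / 2 + 2 + ρ) →
      ∃ C : ℝ, ∀ F : Site d → ℝ, LS24Assumption d K₁ K₂ ρ F →
        ∀ α : List (Fin d), α.length ≤ lsND d ρ →
          ∀ v : UnitAddTorus (Fin d) → ℂ, HasTorusWeakDeriv (ls24fHat F) α v →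
            ∀ j : Fin d, ∀ u : ℝ, 0 ≤ u → u ≤ 1 →
              (∫ t, ‖torusDiff j u v t‖) ≤ C * u ^ η) :
    LiuSlade2024_thm12_critical := by
  intro d hd K₁ K₂ ρ s hK₁ hK₂ hρ hs
  have hd3 : 3 ≤ d := hd
  have hρ0 : 0 < ρ := lt_of_le_of_lt (le_max_right _ _) hρ
  have hs2 : s < 2 := lt_of_lt_of_le hs ((min_le_left _ _).trans (min_le_right _ _))
  -- exponents
  obtain ⟨δ, η, hδ0, hδη, hη1, hsδ, hNη⟩ := ls24_exists_exponents hd3 hρ hs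
  have hδ1 : δ < 1 := hδη.trans hη1
  have hη0 : 0 < η := hδ0.trans hδη
  set N := lsND d ρ with hNdef
  set a : ℝ := δ + N with hadef
  have ha0 : 0 < a := by rw [hadef]; positivity
  have hfract : Int.fract a = δ := by
    rw [hadef, Int.fract_add_natCast, Int.fract_eq_self.2 ⟨hδ0.le, hδ1⟩]
  have hfloor : ⌊a⌋₊ = N := by
    rw [hadef, Nat.floor_add_natCast hδ0.le, Nat.floor_eq_zero.2 hδ1, zero_add]
  -- the three inputs and the asymptotics of `C_1`
  obtain ⟨c, hc0, hc⟩ := LiuSlade2024_lem29_holds d (by omega) a η ha0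
    (by rw [hfract]; exact hδ0.ne') (by rw [hfract]; exact hδη) hη1
  obtain ⟨C₄, hC₄⟩ := h24 d hd K₁ K₂ ρ hK₁ hK₂ hρ
  obtain ⟨C₁₁, hC₁₁⟩ := h211 d hd K₁ K₂ ρ η hK₁ hK₂ hρ hη0 hη1 hNη
  obtain ⟨C_G, hC_G⟩ := srwGreen_asymp_holds d hd
  -- the constant
  set L : ℝ := 2 * Real.pi ^ 2 / (d * K₂) with hL
  have hd0 : (0 : ℝ) < d := by exact_mod_cast (show 0 < d by omega)
  have hL0 : 0 < L := by rw [hL]; positivity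
  refine ⟨c * (max C₄ 0 + max C₁₁ 0 + max C₄ 0) + L * max C_G 0, ?_⟩
  intro F hFs hdec h0 hIR x
  -- Assumption 1.1 in the critical case
  have hFabs : Summable fun y => |F y| := summable_abs_of_decay hdec (by linarith)
  have hF0 : (latticeFourier F 0).re = 0 := by rw [latticeFourier_zero, Complex.ofReal_re, h0]
  have hLS : LS24Assumption d K₁ K₂ ρ F :=
    ⟨hFs, hdec, hF0.ge, fun t => by rw [hF0, sub_zero]; exact hIR t⟩
  obtain ⟨hint, hL1, hweak⟩ := hC₄ F hLS
  -- a family of weak derivatives of `f̂` up to order `n_d`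
  choose! v hv using hweak
  -- Lemma 2.9 for `h = f`
  have hdecay := hc (ls24fHat F) v (max C₁₁ 0) (max C₄ 0) hint
    (fun π ε t => ls24fHat_torusSignedPerm hFs π ε t)
    (fun β hβ => (hv β (by rw [hfloor] at hβ; exact hβ)).1)
    (fun α hα => ((hv α (by rw [hfloor] at hα; exact hα.le)).2).trans (le_max_left _ _))
    (fun α hα j u hu0 hu1 => by
      have hαN : α.length ≤ N := by rw [hfloor] at hα; exact hα.le
      refine (hC₁₁ F hLS α hαN (v α) (hv α hαN).1 j u hu0 hu1).trans ?_
      exact mul_le_mul_of_nonneg_right (le_max_left _ _) (Real.rpow_nonneg hu0 η)) x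
  -- `F'' > 0`, `λ = 1/F'' ≤ 2π²/(dK₂)`
  have hFpp : d * K₂ / (2 * Real.pi ^ 2) ≤ ls24Fpp F := ls24Fpp_ge (by omega) hρ0 hFs hdec h0 hIR
  have hFpp0 : 0 < ls24Fpp F := lt_of_lt_of_le (by positivity) hFpp
  have hlam : ls24Lambda F = (ls24Fpp F)⁻¹ := ls24Lambda_of_tsum_eq_zero h0
  have hlam0 : 0 ≤ ls24Lambda F := by rw [hlam]; positivity
  have hlamL : ls24Lambda F ≤ L := by
    rw [hlam, hL]
    have : (ls24Fpp F)⁻¹ ≤ (d * K₂ / (2 * Real.pi ^ 2))⁻¹ := inv_anti₀ (by positivity) hFpp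
    rwa [inv_div] at this
  -- `G(x) - a_d/(F''⟦x⟧^{d-2}) = f(x) + λ (C_1(x) - a_d ⟦x⟧^{-(d-2)})`
  have hj := jnorm_pos x
  have hj1 := one_le_jnorm x
  have hsplit : fourierInverseG F x -
      gaussianAmp d / (-(∑' y, euclidNorm y ^ 2 * F y) * jnorm x ^ ((d : ℝ) - 2)) =
      (fourierInverseG F x - ls24Lambda F * srwGreen d x) +
        ls24Lambda F * (srwGreen d x - gaussianAmp d / jnorm x ^ ((d : ℝ) - 2)) := by
    have hFpp' : -(∑' y, euclidNorm y ^ 2 * F y) = ls24Fpp F := rfl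
    rw [hFpp', hlam]
    have hne : ls24Fpp F ≠ 0 := hFpp0.ne'
    have hjne : jnorm x ^ ((d : ℝ) - 2) ≠ 0 := (Real.rpow_pos_of_pos hj _).ne'
    field_simp
    ring
  rw [hsplit]
  -- comparison of powers of `⟦x⟧ ≥ 1`
  have hpow_a : 1 / jnorm x ^ a ≤ 1 / jnorm x ^ ((d : ℝ) - 2 + s) := by
    refine one_div_le_one_div_of_le (Real.rpow_pos_of_pos hj _) ?_
    refine Real.rpow_le_rpow_of_exponent_le hj1 ?_
    have : (N : ℝ) + δ ≥ (d : ℝ) - 2 + s := hsδ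
    rw [hadef]; linarith
  have hpow_d : 1 / jnorm x ^ (d : ℝ) ≤ 1 / jnorm x ^ ((d : ℝ) - 2 + s) := by
    refine one_div_le_one_div_of_le (Real.rpow_pos_of_pos hj _) ?_
    exact Real.rpow_le_rpow_of_exponent_le hj1 (by linarith)
  -- the two error terms
  have hL1' : (∫ t, ‖ls24fHat F t‖) ≤ max C₄ 0 := hL1.trans (le_max_left _ _)
  have hI0 : 0 ≤ ∫ t, ‖ls24fHat F t‖ := integral_nonneg fun t => norm_nonneg _
  have h1 : |(mFourierCoeff (ls24fHat F) x).re| ≤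
      c * (max C₄ 0 + max C₁₁ 0 + max C₄ 0) / jnorm x ^ ((d : ℝ) - 2 + s) := by
    refine (Complex.abs_re_le_norm _).trans (hdecay.trans ?_)
    calc c / jnorm x ^ a * ((∫ t, ‖ls24fHat F t‖) + max C₁₁ 0 + max C₄ 0)
        ≤ c / jnorm x ^ a * (max C₄ 0 + max C₁₁ 0 + max C₄ 0) := by
          exact mul_le_mul_of_nonneg_left (by linarith)
            (div_nonneg hc0.le (Real.rpow_nonneg hj.le _))
      _ = c * (max C₄ 0 + max C₁₁ 0 + max C₄ 0) * (1 / jnorm x ^ a) := by ring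
      _ ≤ c * (max C₄ 0 + max C₁₁ 0 + max C₄ 0) * (1 / jnorm x ^ ((d : ℝ) - 2 + s)) := by
          refine mul_le_mul_of_nonneg_left hpow_a ?_
          have := le_max_right C₄ 0; have := le_max_right C₁₁ 0; positivity
      _ = _ := by ring
  have h2 : |ls24Lambda F * (srwGreen d x - gaussianAmp d / jnorm x ^ ((d : ℝ) - 2))| ≤
      L * max C_G 0 / jnorm x ^ ((d : ℝ) - 2 + s) := by
    rw [abs_mul, abs_of_nonneg hlam0]
    calc ls24Lambda F * |srwGreen d x - gaussianAmp d / jnorm x ^ ((d : ℝ) - 2)|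
        ≤ L * (max C_G 0 / jnorm x ^ (d : ℝ)) := by
          refine mul_le_mul hlamL ((hC_G x).trans ?_) (abs_nonneg _) hL0.le
          exact div_le_div_of_nonneg_right (le_max_left _ _) (Real.rpow_nonneg hj.le _)
      _ = L * max C_G 0 * (1 / jnorm x ^ (d : ℝ)) := by ring
      _ ≤ L * max C_G 0 * (1 / jnorm x ^ ((d : ℝ) - 2 + s)) :=
          mul_le_mul_of_nonneg_left hpow_d (mul_nonneg hL0.le (le_max_right _ _))
      _ = _ := by ring
  calc |fourierInverseG F x - ls24Lambda F * srwGreen d x +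
          ls24Lambda F * (srwGreen d x - gaussianAmp d / jnorm x ^ ((d : ℝ) - 2))|
      ≤ |fourierInverseG F x - ls24Lambda F * srwGreen d x| +
          |ls24Lambda F * (srwGreen d x - gaussianAmp d / jnorm x ^ ((d : ℝ) - 2))| :=
        abs_add_le _ _
    _ ≤ c * (max C₄ 0 + max C₁₁ 0 + max C₄ 0) / jnorm x ^ ((d : ℝ) - 2 + s) +
          L * max C_G 0 / jnorm x ^ ((d : ℝ) - 2 + s) := by
        rw [fourierInverseG_sub_lambda_mul_srwGreen hd3 hint h0 x]; exact add_le_add h1 h2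
    _ = (c * (max C₄ 0 + max C₁₁ 0 + max C₄ 0) + L * max C_G 0) / jnorm x ^ ((d : ℝ) - 2 + s) := by
        ring

end Literature.Barriers.CriticalPhenomena.SpreadOutIsing

end
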